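import Summits.BirchSwinnertonDyer.Rank1Residual.X11b.PadicComplexTransport
import Literature.NumberTheory.PAdicHodge.TateTwistInvariants
import Literature.NumberTheory.PAdicHodge.UnramifiedCompletionEmbedding
import Literature.NumberTheory.GaloisRepresentations.UnramifiedPeriodMatrix
import Literature.NumberTheory.GaloisRepresentations.PadicAlgebraOfLocalField
import HarnessLib

/-!
# X11b · S29 K3 (T3, Galois half): Lang's theorem in `ℂ_F` for an unramified rank-one character,
# and Tate's theorem for `ℚ_[p]` with plain scalars (every prime `p`; theorems only)

HONEST FRAMING (cell `b2b-bsdres`, run/shared/lean/b2b/bsd-rank1-residual/, verbatim in every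
file): the goal of the cell is to DELETE the COMBINATION-SHAPED residual classes of the
Birch–Swinnerton-Dyer formula for ALL analytic-rank `≤ 1` elliptic curves over `ℚ` — assembled
STRICTLY from published theorems — so that the rank-`≤ 1` remainder becomes exactly the
CONSTRUCTION-SHAPED classes, which are TYPED, NOT attempted. This is not "finishing BSD". Team
`x11b3` = N8/O2 (X11b at `p = 3`): research routes; nothing booked; no label change; O2 OPEN; the
node of record `Three.HsiehDescentAt₃` is UNCHANGED by this file (sub-target S29 RE-EXPRESSES (t)
⟸ (VR); lead GEN 8 R9-8 / R9-25 / R9-30).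

PROVENANCE: S29 kernel package K3 = [T2 T3 T4 T5], the two Galois-cohomological inputs of
x11b3-p7's `hSen` (r2's (T′)), seat `b2b-bsdres-x11b3-p1` GEN 3; consumed by
`X11b/PadicSemiInvariant.lean`.

* §1 `exists_norm_eq_one_forall_smul_eq_of_unramified` — **Lang's theorem in `ℂ_F`** (any local
  `F ⊇ ℚ_p`): an unramified continuous `ψ : Γ_F →ₜ* ℤ_pˣ` has a unit period `Z ∈ ℂ_F`, `‖Z‖ = 1`,
  `σ • Z = ψ(σ)⁻¹ Z` (tree `IsNonarchimedeanLocalField.exists_isUnit_forall_eq_mul_galAut`, `N = 1`,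
  pushed into `ℂ_F` by the equivariant `maxUnramifiedCompletion.toC`).
* §2 `eq_zero_of_forall_smul_eq_cyclotomicCharacter_pow_padic` — **Tate's theorem for `ℚ_[p]`**
  with plain scalars (`padicRingHom ℚ_[p] = id`): `σ • x = χ(σ)^j x` for all `σ`, `j ≠ 0` ⇒ `x = 0`
  (tree `PAdicHodge.CompletedAlgClosure.eq_zero_of_forall_smul_eq_cyclotomicCharacter_pow`).
* §3 `pos_and_not_dvd_of_isUnit_natCast`, `mem_absInertia_of_forall_rootsOfUnity` — the seam
  between x11b3-p7's `INERTIA(τ)` ("`τ` fixes the prime-to-`p` roots of unity") and the tree's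
  inertia group `absInertia ℚ_[p]` (`mem_absInertia_iff_smul_rootsOfUnity`).

No definition, no named fact, no `sorry`.

References: [Tate1967] §3.3 Thm. 2; [SerreLocalFields1979] Ch. XIII §5 (Lang), Ch. IV §4 Cor. 2 to
Prop. 16; [FontaineOuyang2022] §3.
-/

noncomputable section

open Field ValuativeRel UniformSpace Filter
open scoped Topology

namespace Summit.BirchSwinnertonDyer.Rank1Residual.X11b.PadicSemiInvariant

open Literature.NumberTheory.PAdicHodge
open Literature.NumberTheory.GaloisRepresentations
open Literature.NumberTheory.GaloisRepresentations.IsNonarchimedeanLocalField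

/-! ### §1 Lang's theorem in `ℂ_F` for an unramified rank-one character -/

section Lang

variable {F : Type} [Field F] [ValuativeRel F] [TopologicalSpace F] [IsNonarchimedeanLocalField F]
  {p : ℕ} [Fact p.Prime] [Algebra ℚ_[p] F]

/-- The scalar `ℤ_p → 𝒪̂_{F_nr} → ℂ_F` is `ℤ_p → ℚ_p → F → ℂ_F`. [folklore] -/
theorem toC_padicIntToCompletion (u : ℤ_[p]) :
    maxUnramifiedCompletion.toC F (padicIntToCompletion F p u) =
      algebraMap F (CompletedAlgClosure F) (algebraMap ℚ_[p] F (u : ℚ_[p])) := by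
  rw [padicIntToCompletion, RingHom.comp_apply, toC_algebraMap, coe_padicIntToInteger]

/-- **Lang's theorem, rank one, in `ℂ_F`.** For a continuous UNRAMIFIED character
`ψ : Γ_F →ₜ* ℤ_pˣ` (trivial on the inertia group `I_F`) there is `Z ∈ ℂ_F` with `‖Z‖ = 1` and
`σ • Z = ψ(σ)⁻¹ · Z` for all `σ ∈ Γ_F` (scalars through `ℤ_p → ℚ_p → F → ℂ_F`). This is the case
`N = 1` of the tree's period matrix of an unramified representation over `𝒪̂_{F_nr}`
(`IsNonarchimedeanLocalField.exists_isUnit_forall_eq_mul_galAut`: `X = R(σ)·σ(X)`, `X` a unit),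
pushed into `ℂ_F` by the `Γ_F`-equivariant embedding `maxUnramifiedCompletion.toC`
(`smul_toC`, `norm_toC_le_one`). [cite: SerreLocalFields1979, Ch. XIII §5] -/
theorem exists_norm_eq_one_forall_smul_eq_of_unramified (ψ : absoluteGaloisGroup F →ₜ* ℤ_[p]ˣ)
    (hψ : ∀ σ ∈ absInertia F, ψ σ = 1) :
    ∃ Z : CompletedAlgClosure F, ‖Z‖ = 1 ∧ ∀ σ : absoluteGaloisGroup F,
      σ • Z = algebraMap F (CompletedAlgClosure F)
        (algebraMap ℚ_[p] F (((ψ σ)⁻¹ : ℤ_[p]ˣ) : ℤ_[p])) * Z := by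
  classical
  -- `ψ` as a framed rank-one representation
  set r : absoluteGaloisGroup F →ₜ* GL (Fin 1) ℤ_[p] :=
    (FramedRep.unitsContinuousMulEquivOfUnique (Fin 1) ℤ_[p] :
      ℤ_[p]ˣ →ₜ* GL (Fin 1) ℤ_[p]).comp ψ with hr_def
  have hr_apply : ∀ σ, ((r σ : GL (Fin 1) ℤ_[p]) : Matrix (Fin 1) (Fin 1) ℤ_[p]) 0 0 = (ψ σ : ℤ_[p]) :=
    fun σ => rfl
  have hr : ∀ σ ∈ absInertia F, r σ = 1 := fun σ hσ => by
    change FramedRep.unitsContinuousMulEquivOfUnique (Fin 1) ℤ_[p] (ψ σ) = 1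
    rw [hψ σ hσ, map_one]
  obtain ⟨X, hXu, hX⟩ := exists_isUnit_forall_eq_mul_galAut (p := p) r hr
  -- the entry `z = X 0 0` is a unit with `z = ψ(σ) · σ(z)`
  set z : maxUnramifiedCompletion F := X 0 0 with hz_def
  have hzu : IsUnit z := by
    have h := (Matrix.isUnit_iff_isUnit_det X).1 hXu
    rwa [Matrix.det_fin_one] at h
  have hz : ∀ σ : absoluteGaloisGroup F,
      z = padicIntToCompletion F p (ψ σ : ℤ_[p]) * maxUnramifiedCompletion.galAut F σ z := by
    intro σ
    have h := congrFun (congrFun (hX σ) 0) 0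
    rw [Matrix.mul_apply, Fin.sum_univ_one, RingHom.mapMatrix_apply, Matrix.map_apply] at h
    have hper : periodCoeff (p := p) r σ 0 0 = padicIntToCompletion F p (ψ σ : ℤ_[p]) := by
      change (padicIntToCompletion F p).mapMatrix _ 0 0 = _
      rw [RingHom.mapMatrix_apply, Matrix.map_apply, hr_apply]
    rw [hper] at h
    exact h
  -- hence `σ(z) = ψ(σ)⁻¹ z`
  have hz' : ∀ σ : absoluteGaloisGroup F, maxUnramifiedCompletion.galAut F σ z =
      padicIntToCompletion F p (((ψ σ)⁻¹ : ℤ_[p]ˣ) : ℤ_[p]) * z := by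
    intro σ
    conv_rhs => rw [hz σ]
    rw [← mul_assoc, ← map_mul, Units.inv_mul, map_one, one_mul]
  -- push into `ℂ_F`
  obtain ⟨z', hz'inv⟩ := hzu.exists_right_inv
  refine ⟨maxUnramifiedCompletion.toC F z, ?_, fun σ => ?_⟩
  · have h1 : ‖maxUnramifiedCompletion.toC F z‖ * ‖maxUnramifiedCompletion.toC F z'‖ = 1 := by
      rw [← norm_mul, ← map_mul, hz'inv, map_one, norm_one]
    have hle := norm_toC_le_one (F := F) z
    have hle' := norm_toC_le_one (F := F) z'
    nlinarith [norm_nonneg (maxUnramifiedCompletion.toC F z), norm_nonneg (maxUnramifiedCompletion.toC F z')]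
  · rw [smul_toC, hz', map_mul, toC_padicIntToCompletion]

end Lang

/-! ### §2 Tate's theorem for `ℚ_[p]` with plain scalars -/

section Padic

variable {p : ℕ} [Fact p.Prime] [IsNonarchimedeanLocalField ℚ_[p]]

/-- The continuous embedding `ℚ_p → ℚ_[p]` of the tree (`LocalField.padicRingHom`) is the identity
(uniqueness of continuous ring maps `ℚ_p → ℚ_[p]`, `LocalField.eq_padicRingHom_of_continuous`).
[folklore] -/
theorem padicRingHom_padic_apply (hp : valuation ℚ_[p] (p : ℚ_[p]) < 1) (x : ℚ_[p]) :
    LocalField.padicRingHom ℚ_[p] p hp x = x := by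
  rw [← LocalField.eq_padicRingHom_of_continuous ℚ_[p] p hp (RingHom.id ℚ_[p]) continuous_id]
  rfl

/-- **Tate's theorem `H⁰(Γ_{ℚ_p}, ℂ_{ℚ_p}(χ^j)) = 0`, `j ≠ 0`, with plain scalars**: if
`σ • x = χ_p(σ)^j · x` for all `σ ∈ Γ_{ℚ_p}` (the scalar `χ_p(σ)^j ∈ ℤ_p ⊆ ℚ_p` mapped into
`ℂ_{ℚ_p}`), then `x = 0` (tree
`PAdicHodge.CompletedAlgClosure.eq_zero_of_forall_smul_eq_cyclotomicCharacter_pow` for `F = ℚ_[p]`).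
[cite: Tate1967, §3.3 Theorem 2] -/
theorem eq_zero_of_forall_smul_eq_cyclotomicCharacter_pow_padic {j : ℕ} (hj : j ≠ 0)
    {x : CompletedAlgClosure ℚ_[p]}
    (hx : ∀ σ : absoluteGaloisGroup ℚ_[p], σ • x =
      (algebraMap ℚ_[p] (CompletedAlgClosure ℚ_[p])
        (((GaloisRep.cyclotomicCharacter ℚ_[p] p σ : ℤ_[p]ˣ) : ℤ_[p]) : ℚ_[p])) ^ j * x) :
    x = 0 := by
  have hp : valuation ℚ_[p] (p : ℚ_[p]) < 1 := Padic.valuation_p_lt_one _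
  refine CompletedAlgClosure.eq_zero_of_forall_smul_eq_cyclotomicCharacter_pow hp hj fun σ => ?_
  rw [padicRingHom_padic_apply]
  exact hx σ

/-! ### §3 `INERTIA(τ)` versus `absInertia ℚ_[p]` -/


/-- An integer `N > 0` prime to `p` is a unit of `𝒪[ℚ_[p]]`: equivalently, a unit
`(N : 𝒪[ℚ_[p]])` is positive and prime to `p` (`p ∈ 𝓂[ℚ_[p]]`, tree
`Padic.natCast_mem_maximalIdeal`). [folklore] -/
theorem pos_and_not_dvd_of_isUnit_natCast {N : ℕ} (hN : IsUnit ((N : ℕ) : 𝒪[ℚ_[p]])) :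
    0 < N ∧ ¬ p ∣ N := by
  constructor
  · rcases Nat.eq_zero_or_pos N with rfl | h
    · rw [Nat.cast_zero] at hN; exact absurd hN not_isUnit_zero
    · exact h
  · rintro ⟨k, rfl⟩
    have hmem : ((p * k : ℕ) : 𝒪[ℚ_[p]]) ∈ 𝓂[ℚ_[p]] := by
      rw [Nat.cast_mul]
      exact Ideal.mul_mem_right _ _ (Padic.natCast_mem_maximalIdeal p)
    exact ((IsLocalRing.mem_maximalIdeal _).mp hmem) hN

/-- An automorphism of `ℚ̄_p` fixing every root of unity of order prime to `p` lies in the inertia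
group `I_{ℚ_p}` (tree `mem_absInertia_iff_smul_rootsOfUnity`: `I_F = Gal(F̄/F(μ_{p'}))`).
[cite: SerreLocalFields1979, Ch. IV §4 Cor. 2 to Prop. 16] -/
theorem mem_absInertia_of_forall_rootsOfUnity {τ : absoluteGaloisGroup ℚ_[p]}
    (hτ : ∀ ζ : PadicAlgCl p, (∃ m : ℕ, 0 < m ∧ ¬ p ∣ m ∧ ζ ^ m = 1) →
      absoluteGaloisGroup.toAlgEquiv ℚ_[p] τ ζ = ζ) :
    τ ∈ absInertia ℚ_[p] := by
  rw [mem_absInertia_iff_smul_rootsOfUnity]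
  intro N hN ζ hζ
  obtain ⟨hN0, hNp⟩ := pos_and_not_dvd_of_isUnit_natCast hN
  exact hτ ζ ⟨N, hN0, hNp, hζ⟩

end Padic

end Summit.BirchSwinnertonDyer.Rank1Residual.X11b.PadicSemiInvariant

end
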